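import Summits.ABC.StewartYu.PadicG3TwoExpo
import Mathlib.Algebra.Polynomial.HasseDeriv
import HarnessLib

/-!
# Cell abc-stewartyu, Gen-3 frame at `p = 2` (crux `Y07Two`, stmt-ABC-19659), layer F2: the FAMILY OF
# AUXILIARY `2`-ADIC FUNCTIONS `f_τ` indexed by the multi-index `τ = (t₀; t)` — Hasse weights in `Y₀`,
# powers of the `b`-eliminated directional coefficients, the differential equations, iterated derivatives
# controlled by values, and the `f − φ` comparison

`Summits/ABC/StewartYu/PadicG3TwoFunctions.lean` — cell `abc-stewartyu` (HOME `run/shared/lean/pub/abc-stewartyu/`),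
route `PadicPrimesKummerThird`, seat p3 (g5), F-two LEAD (layer plan HOME/p3/memo-09 §3, F2).  Definitions
(functions of the M2 datum `TwoSetup`) and theorems; no structure, no named fact.  Twin of the M2 file
`PadicTwoFunctions.lean` (lit) with the Gen-3 changes: the unknowns are an ARBITRARY finite family `i ∈ B`
(the frame's Matveev box) carrying SIGNED exponent vectors `(u i, u_θ i)` and an arbitrary `Y₀`-factor
`R i ∈ ℚ[Y₀]` (Nesterenko's `Δ(Y₀; ℓ₀, H)` in the frame); the `Y₀`-weights are HASSE derivatives.

For `τ = (t₀; t) ∈ ℕ × ℕᵈ`: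
* `f_τ(z) = ∑_{i∈B} pᵢ · (Hasse_{t₀} Rᵢ)(z) · ∏ⱼ zγⱼ(i)^{tⱼ} · exp(z·zexpo(i))` (`g3F`), and `φ_τ` with the
  exact exponent `zψ` (`g3Φ`); at an integer point `x`, `φ_τ(x)` is the RATIONAL number
  `g3φ τ x = ∑ pᵢ · (Hasse_{t₀} Rᵢ)(x) · ∏ zγⱼ^{tⱼ} · ∏ αⱼ^{uⱼx} θ^{u_θ x}` (`g3Φ_intCast`) — these are the
  frame's NATIVE identities `g3φ τ x = 0` that `GenThreeEndBridgeTwo.frameOutputTwo_of_hasseIdentities`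
  consumes (after `b_θ^{|t|}·∏ zγⱼ^{tⱼ} = ∏ 𝔛ⱼ^{tⱼ}`, `PadicG3TwoExpo.bθ_mul_zγ`);
* THE DIFFERENTIAL EQUATIONS (`hasDerivAt_g3F`): `d/dz f_τ = (t₀+1)·f_{τ+e₀} + ∑ⱼ lg j · f_{τ+eⱼ}` on
  `‖z‖ < 4` — all coefficients of norm `≤ 1`, hence (`norm_iteratedDeriv_g3F_le_of_forall`) the iterated
  derivatives of `f_τ` at a point are bounded by the values of the family `{f_τ'}`, `|τ'| ≤ |τ| + k`, at
  that point WITHOUT LOSS — the input of the `2`-adic Schwarz step;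
* sizes on `‖z‖ ≤ 2` (`norm_g3F_le`) and the `f − φ` COMPARISON (`norm_g3F_sub_g3Φ_le`, Yu 2013 Lemma 5.1):
  `‖f_τ(z) − φ_τ(z)‖ ≤ Q·2‖Λ₀‖`.

WHAT THIS IS NOT: no box, no Siegel step, no extrapolation; no crux moves.

References: K. Yu, Acta Math. 211 (2013), (5.4)–(5.12), Lemma 5.1; P. L. Cijsouw, M. Waldschmidt,
Compositio Math. 34 (1977) §4 (pp. 186–189); Yu 1990 §1.1, Lemmas 2.2–2.4.
-/

noncomputable section

open NormedSpace Finset IsUltrametricDist Polynomial Metric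
open Literature.NumberTheory.Transcendental
open Literature.NumberTheory.Transcendental.Baker1975 (bump bump_apply sum_bump)
open Literature.NumberTheory.Transcendental.CW77.Setup (Tau tauNorm bump0 bumpj bumpτ tauNorm_bumpτ
  bumpτ_zero bumpτ_succ)
open scoped Nat Topology

namespace Summit.ABC.StewartYu

namespace TwoSetup

variable (S : TwoSetup) {ι : Type*} (R : ι → ℚ[X]) (u : ι → Fin S.d → ℤ) (uθ : ι → ℤ)

/-! ### The `Y₀`-weights (Hasse derivatives, read in `ℚ₂`) -/

/-- The `Y₀`-weight polynomial `Hasse_{t₀} Rᵢ` read in `ℚ₂[X]`. [cite: Yu2013, (5.4)] -/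
def hw (i : ι) (t₀ : ℕ) : ℚ_[2][X] := (hasseDeriv t₀ (R i)).map (algebraMap ℚ ℚ_[2])

/-- At an integer point the weight is the rational number `(Hasse_{t₀} Rᵢ)(x)`. [folklore] -/
theorem hw_eval_intCast (i : ι) (t₀ : ℕ) (x : ℤ) :
    (hw R i t₀).eval (x : ℚ_[2]) = (((hasseDeriv t₀ (R i)).eval (x : ℚ) : ℚ) : ℚ_[2]) := by
  unfold hw
  rw [Polynomial.eval_intCast_map, eq_ratCast]

/-- `d/dY₀ Hasse_{t₀} R = (t₀ + 1)·Hasse_{t₀+1} R`. [folklore] -/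
theorem derivative_hasseDeriv_eq {K : Type*} [CommRing K] (f : K[X]) (t₀ : ℕ) :
    derivative (hasseDeriv t₀ f) = (t₀ + 1) • hasseDeriv (t₀ + 1) f := by
  have h := congrArg (fun (L : K[X] →ₗ[K] K[X]) => L f) (hasseDeriv_comp (R := K) 1 t₀)
  simp only [LinearMap.coe_comp, Function.comp_apply, LinearMap.smul_apply, hasseDeriv_one'] at h
  rw [h, Nat.choose_one_right, add_comm]

/-- The derivative of the weight: `(hw i t₀)' = (t₀+1)·hw i (t₀+1)` (evaluated). [folklore] -/
theorem eval_derivative_hw (i : ι) (t₀ : ℕ) (z : ℚ_[2]) :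
    (derivative (hw R i t₀)).eval z = ((t₀ + 1 : ℕ) : ℚ_[2]) * (hw R i (t₀ + 1)).eval z := by
  unfold hw
  rw [Polynomial.derivative_map, derivative_hasseDeriv_eq]
  have e : ((t₀ + 1) • hasseDeriv (t₀ + 1) (R i)).map (algebraMap ℚ ℚ_[2]) =
      (t₀ + 1) • (hasseDeriv (t₀ + 1) (R i)).map (algebraMap ℚ ℚ_[2]) :=
    map_nsmul (Polynomial.mapRingHom (algebraMap ℚ ℚ_[2])) (t₀ + 1) _
  rw [e, Polynomial.eval_smul, nsmul_eq_mul]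

/-- `z ↦ (hw i t₀)(z)` is smooth. [folklore] -/
theorem contDiffAt_hw (i : ι) (t₀ : ℕ) (n : WithTop ℕ∞) (z : ℚ_[2]) :
    ContDiffAt ℚ_[2] n (fun w => (hw R i t₀).eval w) z := by
  have hc := (Polynomial.contDiff_aeval (𝕜 := ℚ_[2]) (hw R i t₀) n).contDiffAt (x := z)
  have e : (fun w : ℚ_[2] => (hw R i t₀).eval w) = fun w => Polynomial.aeval w (hw R i t₀) := by
    funext w; rw [Polynomial.coe_aeval_eq_eval]
  rw [e]; exact hc

/-! ### The directional monomials `∏ zγⱼ^{tⱼ}` -/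

/-- `∏ⱼ zγⱼ(i)^{tⱼ} ∈ ℚ` (the `t`-th power of the `b`-eliminated directional coefficients).
[cite: CijsouwWaldschmidt1977, §4 (p. 186)] -/
def zγpow (i : ι) (t : Fin S.d → ℕ) : ℚ := ∏ j, S.zγ (u i) (uθ i) j ^ t j

/-- `‖∏ zγⱼ^{tⱼ}‖₂ ≤ 1`. [folklore] -/
theorem norm_zγpow_le (i : ι) (t : Fin S.d → ℕ) : ‖(S.zγpow u uθ i t : ℚ_[2])‖ ≤ 1 := by
  unfold zγpow; push_cast
  rw [norm_prod]
  exact prod_le_one (fun j _ => norm_nonneg _) fun j _ => by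
    rw [norm_pow]; exact pow_le_one₀ (norm_nonneg _) (S.norm_zγ_le _ _ j)

/-- `zγpow(t + eⱼ) = zγpow(t) · zγⱼ` in `ℚ₂`. [folklore] -/
theorem zγpow_bump_cast (i : ι) (t : Fin S.d → ℕ) (j : Fin S.d) :
    (S.zγpow u uθ i (bump t j) : ℚ_[2]) = (S.zγpow u uθ i t : ℚ_[2]) * (S.zγ (u i) (uθ i) j : ℚ_[2]) := by
  unfold zγpow; push_cast
  simp_rw [bump_apply, pow_add, prod_mul_distrib]
  congr 1
  rw [Fintype.prod_eq_single j (fun j' hj' => by rw [if_neg hj', pow_zero]), if_pos rfl, pow_one]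

/-! ### The functions -/

/-- One term of `f_τ`: `(Hasse_{t₀} Rᵢ)(z) · ∏ zγⱼ^{tⱼ} · exp(zexpo(i)·z)`. [cite: Yu2013, (5.9)] -/
def g3termF (i : ι) (τ : Tau S.d) (z : ℚ_[2]) : ℚ_[2] :=
  (hw R i τ.1).eval z * (S.zγpow u uθ i τ.2 : ℚ_[2]) * exp (S.zexpo (u i) (uθ i) * z)

/-- One term of `φ_τ`: the same with the exact exponent `zψ`. [cite: Yu2013, (5.8)] -/
def g3termΦ (i : ι) (τ : Tau S.d) (z : ℚ_[2]) : ℚ_[2] :=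
  (hw R i τ.1).eval z * (S.zγpow u uθ i τ.2 : ℚ_[2]) * exp (S.zψ (u i) (uθ i) * z)

/-- **`f_τ(z) = ∑_{i∈B} pᵢ · g3termF`**. [cite: Yu2013, (5.9)] -/
def g3F (B : Finset ι) (p : ι → ℤ) (τ : Tau S.d) (z : ℚ_[2]) : ℚ_[2] :=
  ∑ i ∈ B, (p i : ℚ_[2]) * S.g3termF R u uθ i τ z

/-- **`φ_τ(z) = ∑_{i∈B} pᵢ · g3termΦ`**. [cite: Yu2013, (5.8)] -/
def g3Φ (B : Finset ι) (p : ι → ℤ) (τ : Tau S.d) (z : ℚ_[2]) : ℚ_[2] :=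
  ∑ i ∈ B, (p i : ℚ_[2]) * S.g3termΦ R u uθ i τ z

/-- **The rational value `φ_τ(x)`** at an integer point `x`:
`∑ pᵢ · (Hasse_{t₀} Rᵢ)(x) · ∏ zγⱼ^{tⱼ} · ∏ αⱼ^{uⱼ x}·θ^{u_θ x}` — the frame's native identity is
`g3φ τ x = 0`. [cite: Yu2013, (5.4)] -/
def g3φ (B : Finset ι) (p : ι → ℤ) (τ : Tau S.d) (x : ℤ) : ℚ :=
  ∑ i ∈ B, (p i : ℚ) * (hasseDeriv τ.1 (R i)).eval (x : ℚ) * S.zγpow u uθ i τ.2 *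
    S.zmon (u i) (uθ i) x

/-- `g3termΦ(x)` is the rational value, cast. [folklore] -/
theorem g3termΦ_intCast (i : ι) (τ : Tau S.d) (x : ℤ) :
    S.g3termΦ R u uθ i τ (x : ℚ_[2]) =
      (((hasseDeriv τ.1 (R i)).eval (x : ℚ) * S.zγpow u uθ i τ.2 * S.zmon (u i) (uθ i) x : ℚ) : ℚ_[2]) := by
  unfold g3termΦ
  rw [hw_eval_intCast R, mul_comm (S.zψ _ _) _, S.exp_intCast_mul_zψ_eq_cast]
  push_cast
  ring

/-- **`φ_τ(x) = g3φ τ x`** (cast) at every integer point `x`. [cite: Yu2013, (5.4)] -/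
theorem g3Φ_intCast (B : Finset ι) (p : ι → ℤ) (τ : Tau S.d) (x : ℤ) :
    S.g3Φ R u uθ B p τ (x : ℚ_[2]) = (S.g3φ R u uθ B p τ x : ℚ_[2]) := by
  unfold g3Φ g3φ
  push_cast
  refine sum_congr rfl fun i _ => ?_
  rw [S.g3termΦ_intCast]; push_cast; ring

/-! ### The differential equations -/

/-- **The derivative of one term**:
`d/dz g3termF_τ = (t₀+1)·g3termF_{τ+e₀} + ∑ⱼ lg j · g3termF_{τ+eⱼ}` on `‖z‖ < 4`.
[cite: CijsouwWaldschmidt1977, §4 (p. 188)] -/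
theorem hasDerivAt_g3termF (i : ι) (τ : Tau S.d) {z : ℚ_[2]} (hz : ‖z‖ < 4) :
    HasDerivAt (S.g3termF R u uθ i τ)
      (((τ.1 + 1 : ℕ) : ℚ_[2]) * S.g3termF R u uθ i (bump0 τ) z +
        ∑ j : Fin S.d, S.lg j * S.g3termF R u uθ i (bumpj τ j) z) z := by
  have h1 : HasDerivAt (fun w => (hw R i τ.1).eval w)
      (((τ.1 + 1 : ℕ) : ℚ_[2]) * (hw R i (τ.1 + 1)).eval z) z := by
    have h := Polynomial.hasDerivAt (hw R i τ.1) z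
    rw [eval_derivative_hw R] at h
    exact h
  have h2 : HasDerivAt (fun w => (S.zγpow u uθ i τ.2 : ℚ_[2]) * exp (S.zexpo (u i) (uθ i) * w))
      ((S.zγpow u uθ i τ.2 : ℚ_[2]) * (S.zexpo (u i) (uθ i) * exp (S.zexpo (u i) (uθ i) * z))) z :=
    (S.hasDerivAt_exp_mul_zexpo (u i) (uθ i) hz).const_mul _
  have hsplit : S.g3termF R u uθ i τ =
      fun w => (hw R i τ.1).eval w * ((S.zγpow u uθ i τ.2 : ℚ_[2]) * exp (S.zexpo (u i) (uθ i) * w)) := by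
    funext w; simp only [g3termF]; ring
  rw [hsplit]
  refine (h1.mul h2).congr_deriv ?_
  have er : ∀ j : Fin S.d, S.lg j * S.g3termF R u uθ i (bumpj τ j) z =
      (hw R i τ.1).eval z * ((S.zγpow u uθ i τ.2 : ℚ_[2]) * exp (S.zexpo (u i) (uθ i) * z)) *
        ((S.zγ (u i) (uθ i) j : ℚ_[2]) * S.lg j) := by
    intro j
    simp only [g3termF, bumpj]
    rw [S.zγpow_bump_cast]
    ring
  simp_rw [er]
  rw [← mul_sum]
  have hexpo : S.zexpo (u i) (uθ i) = ∑ j, (S.zγ (u i) (uθ i) j : ℚ_[2]) * S.lg j := rfl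
  simp only [g3termF, bump0]
  rw [hexpo]
  ring

/-- The coefficients of the differential equation at `τ`: `t₀ + 1` in the `Y₀`-direction, `lg j` in the
direction of `αⱼ`. [cite: CijsouwWaldschmidt1977, §4 (p. 188)] -/
def g3coef (τ : Tau S.d) (i : Fin (S.d + 1)) : ℚ_[2] :=
  Fin.cases (((τ.1 + 1 : ℕ) : ℚ_[2])) (fun j => S.lg j) i

/-- `‖g3coef τ i‖ ≤ 1`. [folklore] -/
theorem norm_g3coef_le (τ : Tau S.d) (i : Fin (S.d + 1)) : ‖S.g3coef τ i‖ ≤ 1 := by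
  refine Fin.cases ?_ (fun j => ?_) i
  · simp only [g3coef, Fin.cases_zero]
    exact_mod_cast Padic.norm_int_le_one (p := 2) ((τ.1 + 1 : ℕ) : ℤ)
  · simp only [g3coef, Fin.cases_succ]
    exact (S.norm_lg_le j).trans (by norm_num)

/-- **`d/dz f_τ = ∑ᵢ cᵢ(τ) f_{τ+eᵢ}`** on `‖z‖ < 4`. [cite: CijsouwWaldschmidt1977, §4 (p. 188)] -/
theorem hasDerivAt_g3F (B : Finset ι) (p : ι → ℤ) (τ : Tau S.d) {z : ℚ_[2]} (hz : ‖z‖ < 4) :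
    HasDerivAt (S.g3F R u uθ B p τ)
      (∑ i : Fin (S.d + 1), S.g3coef τ i * S.g3F R u uθ B p (bumpτ τ i) z) z := by
  unfold g3F
  have h := HasDerivAt.fun_sum fun i (_ : i ∈ B) =>
    (S.hasDerivAt_g3termF R u uθ i τ hz).const_mul (p i : ℚ_[2])
  refine h.congr_deriv ?_
  have h0 : S.g3coef τ 0 = ((τ.1 + 1 : ℕ) : ℚ_[2]) := rfl
  have hs : ∀ j : Fin S.d, S.g3coef τ j.succ = S.lg j := fun j => rfl
  simp only [Fin.sum_univ_succ, h0, hs, bumpτ_zero, bumpτ_succ, mul_add, sum_add_distrib, mul_sum]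
  congr 1
  · exact sum_congr rfl fun i _ => by ring
  · rw [sum_comm]
    exact sum_congr rfl fun j _ => sum_congr rfl fun i _ => by ring

/-- `f_τ` is smooth at every point of `‖z‖ < 4`. [cite: CijsouwWaldschmidt1977, §4 (pp. 186–188)] -/
theorem contDiffAt_g3F (B : Finset ι) (p : ι → ℤ) (τ : Tau S.d) (n : WithTop ℕ∞) {z : ℚ_[2]}
    (hz : ‖z‖ < 4) : ContDiffAt ℚ_[2] n (S.g3F R u uθ B p τ) z := by
  unfold g3F g3termF
  refine ContDiffAt.sum fun i _ => contDiffAt_const.mul ?_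
  exact ((contDiffAt_hw R i τ.1 n z).mul contDiffAt_const).mul
    (S.analyticAt_exp_mul_zexpo (u i) (uθ i) hz).contDiffAt

/-- `deriv f_τ = ∑ᵢ cᵢ(τ) f_{τ+eᵢ}` near every point of `‖z‖ < 4`. [cite: CijsouwWaldschmidt1977, §4 (p. 188)] -/
theorem deriv_g3F_eventuallyEq (B : Finset ι) (p : ι → ℤ) (τ : Tau S.d) {a : ℚ_[2]} (ha : ‖a‖ < 4) :
    deriv (S.g3F R u uθ B p τ) =ᶠ[𝓝 a]
      fun z => ∑ i : Fin (S.d + 1), S.g3coef τ i * S.g3F R u uθ B p (bumpτ τ i) z := by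
  have hball : {z : ℚ_[2] | ‖z‖ < 4} ∈ 𝓝 a := by
    have : {z : ℚ_[2] | ‖z‖ < 4} = Metric.ball 0 4 := by
      ext z; simp
    rw [this]
    exact Metric.isOpen_ball.mem_nhds (by simpa using ha)
  filter_upwards [hball] with z hz using (S.hasDerivAt_g3F R u uθ B p τ hz).deriv

/-- **The iterated derivatives**: `f_τ^{(k+1)}(a) = ∑ᵢ cᵢ(τ) f_{τ+eᵢ}^{(k)}(a)` (`‖a‖ < 4`).
[cite: CijsouwWaldschmidt1977, §4 (11) (p. 189)] -/
theorem iteratedDeriv_g3F_succ (B : Finset ι) (p : ι → ℤ) (τ : Tau S.d) {a : ℚ_[2]} (ha : ‖a‖ < 4)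
    (k : ℕ) :
    iteratedDeriv (k + 1) (S.g3F R u uθ B p τ) a =
      ∑ i : Fin (S.d + 1), S.g3coef τ i * iteratedDeriv k (S.g3F R u uθ B p (bumpτ τ i)) a := by
  rw [iteratedDeriv_succ', (S.deriv_g3F_eventuallyEq R u uθ B p τ ha).iteratedDeriv_eq k,
    iteratedDeriv_fun_sum fun i _ =>
      contDiffAt_const.mul (S.contDiffAt_g3F R u uθ B p (bumpτ τ i) k ha)]
  refine sum_congr rfl fun i _ => ?_
  exact iteratedDeriv_const_mul _ (S.contDiffAt_g3F R u uθ B p (bumpτ τ i) k ha)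

/-- **Derivatives are controlled by values, without loss**: if `‖f_τ'(a)‖ ≤ ε` whenever `|τ'| ≤ N`,
then `‖f_τ^{(k)}(a)‖ ≤ ε` whenever `|τ| + k ≤ N` (`‖a‖ < 4`; all coefficients have norm `≤ 1`).
[cite: CijsouwWaldschmidt1977, §4 (11) (p. 189)] [cite: Yu1990, Lemma 2.4] -/
theorem norm_iteratedDeriv_g3F_le_of_forall (B : Finset ι) (p : ι → ℤ) {a : ℚ_[2]} (ha : ‖a‖ < 4)
    (N : ℕ) {ε : ℝ} (hε0 : 0 ≤ ε)
    (hε : ∀ τ : Tau S.d, tauNorm τ ≤ N → ‖S.g3F R u uθ B p τ a‖ ≤ ε) :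
    ∀ (k : ℕ) (τ : Tau S.d), tauNorm τ + k ≤ N →
      ‖iteratedDeriv k (S.g3F R u uθ B p τ) a‖ ≤ ε := by
  intro k
  induction k with
  | zero => intro τ hτ; simpa using hε τ (by simpa using hτ)
  | succ k ih =>
    intro τ hτ
    rw [S.iteratedDeriv_g3F_succ R u uθ B p τ ha k]
    refine IsUltrametricDist.norm_sum_le_of_forall_le_of_nonneg hε0 fun i _ => ?_
    rw [norm_mul]
    refine (mul_le_of_le_one_left (norm_nonneg _) (S.norm_g3coef_le τ i)).trans (ih _ ?_)
    rw [tauNorm_bumpτ]; omega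

/-! ### Sizes on the disc `‖z‖ ≤ 2` and the `f − φ` comparison -/

/-- **Size of `f_τ` on `‖z‖ ≤ 2`**: `‖f_τ(z)‖ ≤ Q` if `‖(Hasse_{t₀} Rᵢ)(z)‖ ≤ Q` on `B`
(`pᵢ ∈ ℤ`, `‖∏ zγ^{t}‖ ≤ 1`, `‖exp(zexpo·z)‖ = 1`). [cite: Yu1990, Lemma 2.2] -/
theorem norm_g3F_le (B : Finset ι) (p : ι → ℤ) (τ : Tau S.d) {z : ℚ_[2]} (hz : ‖z‖ ≤ 2) {Q : ℝ}
    (hQ0 : 0 ≤ Q) (hQ : ∀ i ∈ B, ‖(hw R i τ.1).eval z‖ ≤ Q) :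
    ‖S.g3F R u uθ B p τ z‖ ≤ Q := by
  unfold g3F
  refine IsUltrametricDist.norm_sum_le_of_forall_le_of_nonneg hQ0 fun i hi => ?_
  unfold g3termF
  rw [norm_mul, norm_mul, norm_mul, norm_exp_mul_eq_one (S.norm_zexpo_le _ _) hz, mul_one]
  calc ‖(p i : ℚ_[2])‖ * (‖(hw R i τ.1).eval z‖ * ‖(S.zγpow u uθ i τ.2 : ℚ_[2])‖)
      ≤ 1 * (Q * 1) := by
        refine mul_le_mul (Padic.norm_int_le_one _) ?_ (by positivity) zero_le_one
        exact mul_le_mul (hQ i hi) (S.norm_zγpow_le u uθ i τ.2) (norm_nonneg _) hQ0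
    _ = Q := by ring

/-- **The `f − φ` comparison on `‖z‖ ≤ 2` (Yu 2013, Lemma 5.1; ultrametric Lemma 9 of Cijsouw–Waldschmidt)**:
`‖f_τ(z) − φ_τ(z)‖ ≤ Q·(2‖Λ₀‖)`, because `g3termF − g3termΦ = hw · zγpow · exp(zψ z)·(exp(u_θ Λ₀ z) − 1)`
and `‖exp w − 1‖ = ‖w‖ ≤ ‖z‖·‖Λ₀‖ ≤ 2‖Λ₀‖`. [cite: Yu2013, Lemma 5.1] -/
theorem norm_g3F_sub_g3Φ_le (B : Finset ι) (p : ι → ℤ) (τ : Tau S.d) {z : ℚ_[2]} (hz : ‖z‖ ≤ 2)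
    {Q : ℝ} (hQ0 : 0 ≤ Q) (hQ : ∀ i ∈ B, ‖(hw R i τ.1).eval z‖ ≤ Q) :
    ‖S.g3F R u uθ B p τ z - S.g3Φ R u uθ B p τ z‖ ≤ Q * (2 * ‖S.Λ₀‖) := by
  unfold g3F g3Φ
  rw [← sum_sub_distrib]
  refine IsUltrametricDist.norm_sum_le_of_forall_le_of_nonneg (by positivity) fun i hi => ?_
  have hz4 : ‖z‖ < 4 := lt_of_le_of_lt hz (by norm_num)
  have hψz : ‖S.zψ (u i) (uθ i) * z‖ < ((2 : ℕ) : ℝ)⁻¹ := norm_mul_lt_half (S.norm_zψ_le _ _) hz4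
  have hδ : ‖(uθ i : ℚ_[2]) * S.Λ₀ * z‖ ≤ 2 * ‖S.Λ₀‖ := by
    rw [norm_mul, norm_mul]
    calc ‖(uθ i : ℚ_[2])‖ * ‖S.Λ₀‖ * ‖z‖ ≤ 1 * ‖S.Λ₀‖ * 2 := by
          refine mul_le_mul (mul_le_mul_of_nonneg_right (Padic.norm_int_le_one _) (norm_nonneg _)) hz
            (norm_nonneg _) (by positivity)
      _ = 2 * ‖S.Λ₀‖ := by ring
  have hδ' : ‖(uθ i : ℚ_[2]) * S.Λ₀ * z‖ < ((2 : ℕ) : ℝ)⁻¹ := by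
    refine lt_of_le_of_lt hδ ?_
    calc 2 * ‖S.Λ₀‖ ≤ 2 * (8 : ℝ)⁻¹ := mul_le_mul_of_nonneg_left S.norm_Λ₀_le (by norm_num)
      _ < ((2 : ℕ) : ℝ)⁻¹ := by norm_num
  have e : (p i : ℚ_[2]) * S.g3termF R u uθ i τ z - (p i : ℚ_[2]) * S.g3termΦ R u uθ i τ z =
      (p i : ℚ_[2]) * ((hw R i τ.1).eval z * (S.zγpow u uθ i τ.2 : ℚ_[2]) *
        exp (S.zψ (u i) (uθ i) * z)) * (exp ((uθ i : ℚ_[2]) * S.Λ₀ * z) - 1) := by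
    simp only [g3termF, g3termΦ, S.zexpo_eq]
    rw [show (S.zψ (u i) (uθ i) + (uθ i : ℚ_[2]) * S.Λ₀) * z =
        S.zψ (u i) (uθ i) * z + (uθ i : ℚ_[2]) * S.Λ₀ * z by ring,
      PadicExp.exp_add (ℓ := 2) hψz hδ']
    ring
  rw [e, norm_mul, norm_mul, norm_mul, norm_mul, PadicExp.norm_exp (ℓ := 2) hψz, mul_one,
    PadicExp.norm_exp_sub_one (ℓ := 2) hδ']
  calc ‖(p i : ℚ_[2])‖ * (‖(hw R i τ.1).eval z‖ * ‖(S.zγpow u uθ i τ.2 : ℚ_[2])‖) *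
        ‖(uθ i : ℚ_[2]) * S.Λ₀ * z‖
      ≤ 1 * (Q * 1) * (2 * ‖S.Λ₀‖) := by
        refine mul_le_mul ?_ hδ (norm_nonneg _) (by positivity)
        refine mul_le_mul (Padic.norm_int_le_one _) ?_ (by positivity) zero_le_one
        exact mul_le_mul (hQ i hi) (S.norm_zγpow_le u uθ i τ.2) (norm_nonneg _) hQ0
    _ = Q * (2 * ‖S.Λ₀‖) := by ring

end TwoSetup

end Summit.ABC.StewartYu

end
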